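/-
Copyright: pub-balaban β-flow team, β-FLOW PROVER 4 (unit `b2b-balaban-beta-bflow-p4`, gen 14; coordinator ruling «YM
ACCELERATION» 2026-08-21 item (2), «work behind the as-printed interface»).  WITNESS ∕ NON-VACUITY for PARTs 27b ∕ 27c at [I] Theorem 2's
G = SU(2): the colour letters (eM, ρ, `hρe`, `htr`) are INHABITED by the Pauli coordinates ℝ³ ≅ 𝔰𝔲(2) (Euclidean inner product = ½·the
Hilbert–Schmidt form), and ROW SCHUR holds OUTRIGHT on ℝ³ for the constant SU(2) gauge rotations (no hypothesis).  Explicit 2 × 2 matrix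
bookkeeping + composition BY NAME; nothing of Bałaban's asserted; NOT N5 for the model, NOT B12 Thm 2, NOT BetaPertH, NOT continuum, NOT Clay.
-/
import Mathlib
import Summits.QuantumFields.BalabanUV.Beta.EriceGaugeFormSchurUnitary

/-!
# `Beta.EriceGaugeFormSchurWitness` — PART 27d of the `EriceLoopExpansionD4` series: the SU(2) colour model (Pauli coordinates) and
# ROW SCHUR on ℝ³, hypothesis-free

Source: T. Bałaban, Commun. Math. Phys. **109** (1987) [Balaban1987RG1] p. 259 «Theorem 2. Let d = 4, G = SU(2), […]», p. 289 after (4.33) (the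
Schur sentence, quoted in PART 27a: «𝐄_ab = 𝐄δ_ab, and then ⟨𝐄, A⊗B⟩ = 𝐄 tr AB»); T. Bałaban, A. Jaffe, *Constructive gauge theory* (Erice
1985) [BalabanJaffe1986], Part III p. 247 (3.51) «V″ = exp(iB)», (3.55).  Tree inputs BY NAME: `CompactKillingForm.su` ∕ `hsForm`, PART 27b
`EriceGaugeFormSchurUnitary.hSchur_su_of_trace`.

WHAT IS KERNEL-CHECKED HERE (def-free; [folklore] 2 × 2 matrix bookkeeping + composition BY NAME):
* **`su2_colour_model`** — THE LETTER FAMILY OF PARTs 27b ∕ 27c IS INHABITED AT N = 2: there are `eM : EuclideanSpace ℝ (Fin 3) ≃ₗ[ℝ] 𝔰𝔲(2)`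
  and `ρ : EuclideanSpace ℝ (Fin 3) →L[ℝ] M₂(ℂ)` with ρ(m) = i(m₀σ₁ + m₁σ₂ + m₂σ₃) = [[i m₂, m₁ + i m₀], [−m₁ + i m₀, −i m₂]] (print's «iB»,
  B = m·σ Hermitian), `hρe : ρ m = eM m`, and the TRACE READING `htr` with c = ½: ⟪m, m′⟫ = ½·Re tr(ρ(m)ᴴρ(m′)) (tr σₖσₗ = 2δₖₗ).
* **`hSchur_su2_euclidean`** — ROW SCHUR AT [I] THEOREM 2's G = SU(2), NO HYPOTHESIS: every bilinear form on ℝ³ invariant under the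
  constant SU(2) gauge rotations {g ∣ ∃ u ∈ SU(2), ρ(g m) = uρ(m)u⁻¹} (= SO(3) acting on ℝ³) is a multiple of the Euclidean inner product
  (PART 27b `hSchur_su_of_trace` fed with the model).
HONEST: [folklore]; a witness that the SU(N) letters of PARTs 27b ∕ 27c are satisfiable and that the discharged row is not vacuous at print's
group; the curvature road's other hypotheses (□₂'s readings, `hQinv`, K₀ ∕ H1R, (3.55) on F, COV, FRAME, TOL) are untouched; nothing of
Bałaban's 𝓔^{(j)} asserted; NOT N5 for the model, NOT (3.36), NOT B12 Thm 2, NOT BetaPertH, NOT continuum, NOT Clay.  HONEST DEPENDENCY: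
continuum YM on T⁴ ⇐ BetaPertH ∧ nine spine estimates (0/9 proved); BetaPertH ⇐ (D1) ∧ (D4) ∧ CAP+tail; G-an2-4 gates asym, D1 and NE2/3/4.
-/

namespace Summit.QuantumFields.BalabanUV.Beta.EriceGaugeFormSchurWitness

open scoped RealInnerProductSpace Matrix.Norms.L2Operator ComplexConjugate Matrix
open Complex (I)
open Literature.Algebra.Lie.CompactKillingForm (su mem_su_iff hsForm hsForm_apply)
open Summit.QuantumFields.BalabanUV.Beta.EriceGaugeFormSchurUnitary (hSchur_su_of_trace)

/-! ## §1. The SU(2) colour model: Pauli coordinates ℝ³ ≅ 𝔰𝔲(2) -/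

/-- **THE SU(2) COLOUR MODEL (letters of PARTs 27b ∕ 27c inhabited at N = 2).**  ρ(m) = i(m₀σ₁ + m₁σ₂ + m₂σ₃) = [[i m₂, m₁ + i m₀],
[−m₁ + i m₀, −i m₂]] maps ℝ³ linearly and bijectively onto 𝔰𝔲(2) = {Xᴴ = −X, tr X = 0} ⊂ M₂(ℂ) (`eM`, `hρe`), and the Euclidean inner product
is the trace reading with c = ½: ⟪m, m′⟫ = ½·Re tr(ρ(m)ᴴρ(m′)). [folklore] (print: Balaban1987RG1 p.259 «G = SU(2)»; BalabanJaffe1986 (3.51) p.247) -/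
theorem su2_colour_model :
    ∃ (eM : EuclideanSpace ℝ (Fin 3) ≃ₗ[ℝ] su (Fin 2)) (ρ : EuclideanSpace ℝ (Fin 3) →L[ℝ] Matrix (Fin 2) (Fin 2) ℂ),
      (∀ m, ρ m = Matrix.of ![![((m 2 : ℝ) : ℂ) * I, ((m 1 : ℝ) : ℂ) + ((m 0 : ℝ) : ℂ) * I],
        ![-((m 1 : ℝ) : ℂ) + ((m 0 : ℝ) : ℂ) * I, -(((m 2 : ℝ) : ℂ) * I)]]) ∧
      (∀ m, ρ m = ((eM m : su (Fin 2)) : Matrix (Fin 2) (Fin 2) ℂ)) ∧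
      (∀ m m', ⟪m, m'⟫ = (1 / 2 : ℝ) * hsForm (Fin 2) (ρ m) (ρ m')) := by
  -- the linear map
  let ρf : EuclideanSpace ℝ (Fin 3) → Matrix (Fin 2) (Fin 2) ℂ := fun m =>
    Matrix.of ![![((m 2 : ℝ) : ℂ) * I, ((m 1 : ℝ) : ℂ) + ((m 0 : ℝ) : ℂ) * I],
      ![-((m 1 : ℝ) : ℂ) + ((m 0 : ℝ) : ℂ) * I, -(((m 2 : ℝ) : ℂ) * I)]]
  have hadd : ∀ m m', ρf (m + m') = ρf m + ρf m' := fun m m' => by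
    ext i j; fin_cases i <;> fin_cases j <;> simp [ρf] <;> ring
  have hsmul : ∀ (r : ℝ) m, ρf (r • m) = r • ρf m := fun r m => by
    ext i j; fin_cases i <;> fin_cases j <;> simp [ρf, Complex.real_smul] <;> ring
  let ρ₀ : EuclideanSpace ℝ (Fin 3) →ₗ[ℝ] Matrix (Fin 2) (Fin 2) ℂ := ⟨⟨ρf, hadd⟩, hsmul⟩
  have hρ₀ : ∀ m, ρ₀ m = ρf m := fun m => rfl
  -- values in 𝔰𝔲(2)
  have hmem : ∀ m, ρ₀ m ∈ su (Fin 2) := fun m => by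
    rw [mem_su_iff, hρ₀]
    refine ⟨?_, ?_⟩
    · ext i j; fin_cases i <;> fin_cases j <;> simp [ρf, Matrix.conjTranspose_apply] <;> ring
    · simp [ρf, Matrix.trace_fin_two]
  -- injective
  have hinj : Function.Injective (fun m => (⟨ρ₀ m, hmem m⟩ : su (Fin 2))) := by
    intro m m' h
    have h' : ρf m = ρf m' := by simpa [hρ₀] using congrArg (fun X : su (Fin 2) => (X : Matrix (Fin 2) (Fin 2) ℂ)) h
    have h00 := congrFun (congrFun h' 0) 0
    have h01 := congrFun (congrFun h' 0) 1
    simp only [ρf, Matrix.of_apply, Matrix.cons_val_zero, Matrix.cons_val_one, Complex.ext_iff] at h00 h01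
    simp at h00 h01
    ext i
    fin_cases i
    · exact h01.2
    · exact h01.1
    · exact h00
  -- surjective
  have hsurj : Function.Surjective (fun m => (⟨ρ₀ m, hmem m⟩ : su (Fin 2))) := by
    intro X
    obtain ⟨hX, htr⟩ := (mem_su_iff (n := Fin 2)).1 X.2
    have h00 := congrFun (congrFun hX 0) 0
    have h10 := congrFun (congrFun hX 1) 0
    have h11 := congrFun (congrFun hX 1) 1
    simp only [Matrix.conjTranspose_apply, Matrix.neg_apply] at h00 h10 h11
    rw [Matrix.trace_fin_two] at htr
    have f1 := congrArg Complex.re h00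
    have f2 := congrArg Complex.re h10
    have f3 := congrArg Complex.im h10
    have f4 := congrArg Complex.re h11
    have f6 := congrArg Complex.im htr
    simp at f1 f2 f3 f4 f6
    set Y : Matrix (Fin 2) (Fin 2) ℂ := (X : Matrix (Fin 2) (Fin 2) ℂ) with hY
    have e00 : (((Y 0 0).im : ℝ) : ℂ) * I = Y 0 0 := Complex.ext (by simp; linarith) (by simp)
    have e10 : -(((Y 0 1).re : ℝ) : ℂ) + (((Y 0 1).im : ℝ) : ℂ) * I = Y 1 0 :=
      Complex.ext (by simp; linarith) (by simp; linarith)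
    have e11 : -((((Y 0 0).im : ℝ) : ℂ) * I) = Y 1 1 := Complex.ext (by simp; linarith) (by simp; linarith)
    refine ⟨WithLp.toLp 2 ![(Y 0 1).im, (Y 0 1).re, (Y 0 0).im], Subtype.ext ?_⟩
    change ρf _ = Y
    ext i j
    fin_cases i <;> fin_cases j
    · simpa [ρf] using e00
    · simp [ρf]
    · simpa [ρf] using e10
    · simpa [ρf] using e11
  let eM : EuclideanSpace ℝ (Fin 3) ≃ₗ[ℝ] su (Fin 2) :=
    LinearEquiv.ofBijective
      ({ toFun := fun m => ⟨ρ₀ m, hmem m⟩, map_add' := fun m m' => Subtype.ext (map_add ρ₀ m m'),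
         map_smul' := fun r m => Subtype.ext (map_smul ρ₀ r m) } : EuclideanSpace ℝ (Fin 3) →ₗ[ℝ] su (Fin 2))
      ⟨hinj, hsurj⟩
  refine ⟨eM, LinearMap.toContinuousLinearMap ρ₀, fun m => rfl, fun m => rfl, fun m m' => ?_⟩
  -- the trace reading with c = ½
  rw [LinearMap.coe_toContinuousLinearMap', hρ₀, hρ₀, hsForm_apply]
  have hinner : ⟪m, m'⟫ = m 0 * m' 0 + m 1 * m' 1 + m 2 * m' 2 := by
    simp [PiLp.inner_apply, Fin.sum_univ_three, mul_comm]
  rw [hinner]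
  simp [ρf, Matrix.trace_fin_two, Matrix.mul_apply, Fin.sum_univ_two, Matrix.conjTranspose_apply, Complex.mul_re, Complex.mul_im]
  ring

/-! ## §2. ROW SCHUR at [I] Theorem 2's G = SU(2), hypothesis-free -/

/-- **ROW SCHUR ON ℝ³ FOR THE CONSTANT SU(2) GAUGE ROTATIONS — NO HYPOTHESIS** ([I] Theorem 2's group; p. 289 «𝐄_ab = 𝐄δ_ab»): with ρ the Pauli
coordinates of `su2_colour_model`, every bilinear form A on `EuclideanSpace ℝ (Fin 3)` invariant under every g with ρ(g m) = uρ(m)u⁻¹ for some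
u ∈ SU(2) (these g are the rotations SO(3) = Ad(SU(2))) is a·⟪·,·⟫ — PART 27b `hSchur_su_of_trace` at N = 2 fed with the model.
[cite: Balaban1987RG1, p.259, p.289 after (4.33)] -/
theorem hSchur_su2_euclidean :
    ∃ ρ : EuclideanSpace ℝ (Fin 3) →L[ℝ] Matrix (Fin 2) (Fin 2) ℂ,
      (∀ m, ρ m = Matrix.of ![![((m 2 : ℝ) : ℂ) * I, ((m 1 : ℝ) : ℂ) + ((m 0 : ℝ) : ℂ) * I],
        ![-((m 1 : ℝ) : ℂ) + ((m 0 : ℝ) : ℂ) * I, -(((m 2 : ℝ) : ℂ) * I)]]) ∧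
      ∀ A : EuclideanSpace ℝ (Fin 3) →ₗ[ℝ] EuclideanSpace ℝ (Fin 3) →ₗ[ℝ] ℝ,
        (∀ g ∈ {g : EuclideanSpace ℝ (Fin 3) →ₗ[ℝ] EuclideanSpace ℝ (Fin 3) |
            ∃ u ∈ ((Matrix.specialUnitaryGroup (Fin 2) ℂ).units : Set (Matrix (Fin 2) (Fin 2) ℂ)ˣ),
              ∀ m, ρ (g m) = (u : Matrix (Fin 2) (Fin 2) ℂ) * ρ m * ((u⁻¹ : (Matrix (Fin 2) (Fin 2) ℂ)ˣ) : Matrix (Fin 2) (Fin 2) ℂ)},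
          ∀ m m', A (g m) (g m') = A m m') →
        ∃ a : ℝ, ∀ m m', A m m' = a * ⟪m, m'⟫ := by
  obtain ⟨eM, ρ, hρ, hρe, htr⟩ := su2_colour_model
  exact ⟨ρ, hρ, hSchur_su_of_trace (N := 2) le_rfl eM ρ hρe ⟨1 / 2, htr⟩⟩

end Summit.QuantumFields.BalabanUV.Beta.EriceGaugeFormSchurWitness
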